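import Summits.NavierStokesRegularity.NavierStokesRegularity.Theorems.CriticalSwirlRegularity.Negative.SelfSimilarMomentumCalculus
import Summits.NavierStokesRegularity.NavierStokesRegularity.Theorems.EulerProximatePump.Negative.ClassicalTypeIToMildLerayHopf

/-!
# The locally-thin flat swirl gauge carries no a-priori modulus: `stub_momentumUniformContinuity` is false

Negative-side support for the crux `CriticalSwirlRegularity` (stmt-NavierStokesRegularity-1253, route
`FlatSwirlGauge`), line `registered` (birth skeleton `Cruxes/CriticalSwirlRegularity/Lines/birth.lean`), by the
line lead (2026-08-17). Theorems only (no definitions).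

The birth skeleton cuts the crux as "a-priori modulus + criterion": its load-bearing stub
`stub_momentumUniformContinuity` claims that for a classical Leray–Hopf solution `(u,p)` on `[0,T) × ℝ³` every
AXIS-LIKE flat swirl gauge `(ρ, C₀, M, α, b, d)` on a backward cylinder `Q_ρ(T,x₀)` (bounded `C²` momentum `α`,
`ω·∇α = 0`, chart nondegeneracy `‖ω‖ d ≤ C₀‖∇α‖`, flat transport `(∂ₜ + u·∇)α = ν(Δα + ⟪b,∇α⟫)` with `‖b‖ d ≤ C₀`
wherever `d > 0`, and the LOCAL thinness `vol({d<δ} ∩ B(y,s)) ≤ C₀δ²s` over sub-balls) has a momentum `α` that is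
UNIFORMLY CONTINUOUS on some smaller cylinder `Q_{ρ₂}(T,x₀)` up to the final time.

This is false already for the rest state `u ≡ 0`, `p ≡ 0` (`stub_momentumUniformContinuity_false`). Witness
(`restState_axisGauge`; the rapid decay of the zero datum is the in-tree
`EulerProximatePump.Negative.hasRapidSpatialDecay_zero`): `x₀ = 0`, any `ν > 0`, `0 < ρ`, `ρ² < T`, and
* momentum `α(t,x) = x₂ / √(ν(T−t) + ‖x‖²)` — the backward self-similar profile `H(ξ) = ξ₂/√(1+‖ξ‖²)`, `|α| ≤ 1`,
  smooth for `t < T`, and `α(t,·) → x₂/‖x‖` as `t ↑ T`, which is NOT uniformly continuous at the vertex `(T,0)`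
  (`not_uniformlyContinuous_momentum`: `α(t, λe₂) − α(t, 0) > 1/2` as soon as `ν(T−t) ≤ λ²`);
* degeneracy function `d = r = cylRadius` (distance to the `x₂`-axis), locally 1-thin by the in-tree tube estimate
  `volume_cylRadius_lt_inter_ball_le`: `vol({r<δ} ∩ B(y,s)) ≤ 8δ²s`;
* drift `b = ((∂ₜα/ν − Δα)/‖∇α‖²) ∇α`, for which the transport law holds by construction and
  `‖b‖ r ≤ 11/2`: with `S = ν(T−t) + ‖x‖²` one has `∂ₜα = (ν/2) x₂ S^{-3/2}`,
  `Δα = −3ν(T−t) x₂ S^{-5/2} − 2x₂S^{-3/2}`, so `|∂ₜα/ν − Δα| ≤ (11/2)|x₂| S^{-3/2}`, while the derivative of `α`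
  along the horizontal vector `(x₀,x₁,0)` is `−x₂ r² S^{-3/2}`, whence `‖∇α‖ ≥ |x₂| r S^{-3/2}`;
* constants `C₀ = 8`, `M = 1`; the vorticity clauses are trivial (`curl 0 = 0`).

Information for the planners (why the LINE, not only the stub, is in trouble): the v0 gauge block constrains the
axis-type drift only through `‖b‖ d ≤ C₀`; a critical drift of size `(11/2)/r` of the wrong direction focuses a
bounded momentum into the discontinuous profile `x₂/‖x‖` in finite time even with NO fluid motion, so the gauge
class carries no modulus whatsoever (the exactly-flat model `b = −(2/r)e_r` is regularising because of its specific
structure — `Γ/r²` is 5-D caloric — not because of the bound `‖b‖ r ≤ 2`). Any repaired modulus stub must use the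
singular hypothesis on `u` essentially (a non-quantitative blow-up argument: the family `T ↦ T + λ`, `λ ↓ 0`, has
fixed constants `C₀ = 8`, `M = 1` and no common modulus), and zooming without a Type-I rate produces exactly such
rest-state limits.
-/

noncomputable section

namespace Summit.NavierStokesRegularity.NavierStokesRegularity.Theorems.CriticalSwirlRegularity.Negative

open MeasureTheory Filter Set Metric Real InnerProductSpace
open scoped RealInnerProductSpace Laplacian
open Literature.Analysis.FluidPDE

/-! ### The rest state carries an axis-like flat swirl gauge with the self-similar momentum -/

/-- The horizontal vector `(x₀, x₁, 0)` has norm `r = cylRadius x`, vanishing third coordinate and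
`⟪x, (x₀,x₁,0)⟫ = r²`. [folklore] -/
theorem horizontal_vector_facts (x : EuclideanSpace ℝ (Fin 3)) :
    ‖EuclideanSpace.single (0 : Fin 3) (x 0) + EuclideanSpace.single (1 : Fin 3) (x 1)‖ = cylRadius x ∧
      (EuclideanSpace.single (0 : Fin 3) (x 0) + EuclideanSpace.single (1 : Fin 3) (x 1)) 2 = 0 ∧
      ⟪x, EuclideanSpace.single (0 : Fin 3) (x 0) + EuclideanSpace.single (1 : Fin 3) (x 1)⟫ =
        cylRadius x ^ 2 := by
  refine ⟨?_, ?_, ?_⟩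
  · rw [EuclideanSpace.norm_eq, cylRadius]
    congr 1
    simp [Fin.sum_univ_three, PiLp.single_apply]
  · simp
  · rw [inner_add_right, EuclideanSpace.inner_single_right, EuclideanSpace.inner_single_right, cylRadius_sq]
    simp
    ring

/-- **The witness.** On the rest state `u ≡ 0` (any `ν > 0`, `0 < ρ`, `ρ² < T`, vertex `x₀ = 0`) the momentum
`α(t,x) = x₂/√(ν(T−t)+‖x‖²)`, the degeneracy function `d = cylRadius` and the drift
`b = ((∂ₜα/ν − Δα)/‖∇α‖²)∇α` satisfy every clause of the LOCALLY-THIN flat swirl gauge block of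
`stub_momentumUniformContinuity` with `C₀ = 8`, `M = 1`: `α` is `C²` on the cylinder, `|α| ≤ 1`, the vorticity
clauses are trivial (`curl 0 = 0`), the tube `{r < δ}` meets every ball `B(y,s)` in volume `≤ 8δ²s`, the transport law
holds by the choice of `b`, and `‖b‖ r ≤ 11/2 ≤ 8` (module docstring for the computation). [folklore] -/
theorem restState_axisGauge {ν T ρ : ℝ} (hν : 0 < ν) (hρ : 0 < ρ) (hρT : ρ ^ 2 < T) :
    ∃ b : ℝ → EuclideanSpace ℝ (Fin 3) → EuclideanSpace ℝ (Fin 3),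
      0 < ρ ∧ ρ ^ 2 < T ∧
        ContDiffOn ℝ 2
          (Function.uncurry fun (t : ℝ) (x : EuclideanSpace ℝ (Fin 3)) =>
            x 2 * (Real.sqrt (ν * (T - t) + ‖x‖ ^ 2))⁻¹)
          (Set.Ioo (T - ρ ^ 2) T ×ˢ Metric.ball (0 : EuclideanSpace ℝ (Fin 3)) ρ) ∧
        (∀ t ∈ Set.Ioo (T - ρ ^ 2) T, ∀ (y : EuclideanSpace ℝ (Fin 3)) (s : ℝ), 0 < s →
          Metric.ball y s ⊆ Metric.ball (0 : EuclideanSpace ℝ (Fin 3)) ρ →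
          ∀ δ ∈ Set.Ioo 0 s, MeasureTheory.volume ({x : EuclideanSpace ℝ (Fin 3) | cylRadius x < δ} ∩
            Metric.ball y s) ≤ ENNReal.ofReal (8 * δ ^ 2 * s)) ∧
        (∀ t ∈ Set.Ioo (T - ρ ^ 2) T, ∀ x ∈ Metric.ball (0 : EuclideanSpace ℝ (Fin 3)) ρ,
          |x 2 * (Real.sqrt (ν * (T - t) + ‖x‖ ^ 2))⁻¹| ≤ 1 ∧
          ⟪curl (0 : EuclideanSpace ℝ (Fin 3) → EuclideanSpace ℝ (Fin 3)) x,
            gradient (fun x : EuclideanSpace ℝ (Fin 3) => x 2 * (Real.sqrt (ν * (T - t) + ‖x‖ ^ 2))⁻¹) x⟫ = 0 ∧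
          (0 < cylRadius x →
            ‖curl (0 : EuclideanSpace ℝ (Fin 3) → EuclideanSpace ℝ (Fin 3)) x‖ * cylRadius x ≤
                8 * ‖gradient (fun x : EuclideanSpace ℝ (Fin 3) =>
                  x 2 * (Real.sqrt (ν * (T - t) + ‖x‖ ^ 2))⁻¹) x‖ ∧
              ‖b t x‖ * cylRadius x ≤ 8 ∧
              deriv (fun s => x 2 * (Real.sqrt (ν * (T - s) + ‖x‖ ^ 2))⁻¹) t +
                  convect (0 : EuclideanSpace ℝ (Fin 3) → EuclideanSpace ℝ (Fin 3))
                    (fun x : EuclideanSpace ℝ (Fin 3) => x 2 * (Real.sqrt (ν * (T - t) + ‖x‖ ^ 2))⁻¹) x =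
                ν * (Laplacian.laplacian (fun x : EuclideanSpace ℝ (Fin 3) =>
                    x 2 * (Real.sqrt (ν * (T - t) + ‖x‖ ^ 2))⁻¹) x +
                  ⟪b t x, gradient (fun x : EuclideanSpace ℝ (Fin 3) =>
                    x 2 * (Real.sqrt (ν * (T - t) + ‖x‖ ^ 2))⁻¹) x⟫))) := by
  -- the drift: `b = (E/‖∇α‖²) ∇α` with `E = ∂ₜα/ν − Δα`
  refine ⟨fun t x =>
    ((deriv (fun s => x 2 * (Real.sqrt (ν * (T - s) + ‖x‖ ^ 2))⁻¹) t / ν -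
        (Δ (fun y : EuclideanSpace ℝ (Fin 3) => y 2 * (Real.sqrt (ν * (T - t) + ‖y‖ ^ 2))⁻¹)) x) /
      ‖gradient (fun y : EuclideanSpace ℝ (Fin 3) => y 2 * (Real.sqrt (ν * (T - t) + ‖y‖ ^ 2))⁻¹) x‖ ^ 2) •
      gradient (fun y : EuclideanSpace ℝ (Fin 3) => y 2 * (Real.sqrt (ν * (T - t) + ‖y‖ ^ 2))⁻¹) x,
    hρ, hρT, ?_, ?_, ?_⟩
  · -- `α` is `C²` on the cylinder
    exact contDiffOn_momentum hν
  · -- the tube around the axis is locally 1-thin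
    exact fun t _ y s _ _ δ hδ => volume_cylRadius_lt_inter_ball_le y s hδ.1.le
  · intro t ht x hx
    rw [Set.mem_Ioo] at ht
    have hτ : 0 < ν * (T - t) := mul_pos hν (by linarith [ht.2])
    have hS : 0 < ν * (T - t) + ‖x‖ ^ 2 := by positivity
    have hq0 : 0 < Real.sqrt (ν * (T - t) + ‖x‖ ^ 2) := Real.sqrt_pos.2 hS
    have hq : 0 < (Real.sqrt (ν * (T - t) + ‖x‖ ^ 2))⁻¹ := inv_pos.2 hq0
    have hq2 : ((Real.sqrt (ν * (T - t) + ‖x‖ ^ 2))⁻¹) ^ 2 * (ν * (T - t) + ‖x‖ ^ 2) = 1 := by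
      rw [inv_pow, Real.sq_sqrt hS.le, inv_mul_cancel₀ hS.ne']
    have hx2 : |x 2| ≤ ‖x‖ := by
      have := PiLp.norm_apply_le x 2
      rwa [Real.norm_eq_abs] at this
    have hxq : ‖x‖ ^ 2 * ((Real.sqrt (ν * (T - t) + ‖x‖ ^ 2))⁻¹) ^ 2 ≤ 1 := by
      nlinarith [sq_nonneg ‖x‖, sq_nonneg ((Real.sqrt (ν * (T - t) + ‖x‖ ^ 2))⁻¹)]
    -- the explicit derivatives
    have hD : deriv (fun s => x 2 * (Real.sqrt (ν * (T - s) + ‖x‖ ^ 2))⁻¹) t =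
        ν / 2 * x 2 * ((Real.sqrt (ν * (T - t) + ‖x‖ ^ 2))⁻¹) ^ 3 :=
      (hasDerivAt_momentum_time x hS).deriv
    have hL := laplacian_momentumSlice hτ x
    -- the gradient: lower bound along the horizontal vector `(x₀, x₁, 0)`
    obtain ⟨hvn, hv2, hvi⟩ := horizontal_vector_facts x
    have hdir : |x 2| * ((Real.sqrt (ν * (T - t) + ‖x‖ ^ 2))⁻¹) ^ 3 * cylRadius x ^ 2 ≤
        ‖gradient (fun y : EuclideanSpace ℝ (Fin 3) => y 2 * (Real.sqrt (ν * (T - t) + ‖y‖ ^ 2))⁻¹) x‖ *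
          cylRadius x := by
      have h := abs_fderiv_le_norm_gradient_mul
        (fun y : EuclideanSpace ℝ (Fin 3) => y 2 * (Real.sqrt (ν * (T - t) + ‖y‖ ^ 2))⁻¹) x
        (EuclideanSpace.single (0 : Fin 3) (x 0) + EuclideanSpace.single (1 : Fin 3) (x 1))
      rwa [fderiv_momentumSlice_apply hτ, hv2, hvi, hvn, zero_mul, zero_sub, abs_neg, abs_mul, abs_mul,
        abs_of_pos (pow_pos hq 3), abs_of_nonneg (sq_nonneg (cylRadius x))] at h
    -- the drift numerator and its bound
    have hE : |deriv (fun s => x 2 * (Real.sqrt (ν * (T - s) + ‖x‖ ^ 2))⁻¹) t / ν -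
        (x 2 * (3 * ((Real.sqrt (ν * (T - t) + ‖x‖ ^ 2))⁻¹) ^ 5 * ‖x‖ ^ 2 -
          3 * ((Real.sqrt (ν * (T - t) + ‖x‖ ^ 2))⁻¹) ^ 3) -
          2 * x 2 * ((Real.sqrt (ν * (T - t) + ‖x‖ ^ 2))⁻¹) ^ 3)| ≤
        11 / 2 * (|x 2| * ((Real.sqrt (ν * (T - t) + ‖x‖ ^ 2))⁻¹) ^ 3) := by
      rw [hD, drift_numerator_eq hν.ne']
      exact drift_numerator_abs_le hq hxq
    refine pointwise_clause hν.ne' (abs_momentum_le_one hx2 hxq) hL hE hdir ?_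
    -- where `∇α(x) = 0` and `r > 0`: `x₂ = 0`, so `∂ₜα` and `Δα` vanish at `x`
    intro hg0 hr
    have hx0 : x 2 = 0 := by
      by_contra hx0
      have hm : 0 < |x 2| * ((Real.sqrt (ν * (T - t) + ‖x‖ ^ 2))⁻¹) ^ 3 * cylRadius x ^ 2 :=
        mul_pos (mul_pos (abs_pos.2 hx0) (pow_pos hq 3)) (pow_pos hr 2)
      rw [hg0, norm_zero, zero_mul] at hdir
      linarith
    refine ⟨?_, ?_⟩
    · rw [hD, hx0]; ring
    · rw [hx0]; ring

/-- **No modulus at the vertex.** The momentum `α(t,x) = x₂/√(ν(T−t)+‖x‖²)` is NOT uniformly continuous on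
any backward cylinder `Q_{ρ₂}(T,0)`: for `ε = 1/2` and any `η > 0`, the points `x = λe₂`, `y = 0`
(`λ = min η (ρ₂/2)`) at the common time `t = s = T − μ`, `νμ ≤ λ²`, have `|α(t,x) − α(t,y)| = λ/√(νμ+λ²) > 1/2`. [folklore] -/
theorem not_uniformlyContinuous_momentum {ν T ρ : ℝ} (hν : 0 < ν) :
    ¬ (∃ ρ₂ : ℝ, 0 < ρ₂ ∧ ρ₂ ≤ ρ ∧
      (∀ ε : ℝ, 0 < ε → ∃ η : ℝ, 0 < η ∧
        ∀ t ∈ Set.Ioo (T - ρ₂ ^ 2) T, ∀ s ∈ Set.Ioo (T - ρ₂ ^ 2) T,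
          ∀ x ∈ Metric.ball (0 : EuclideanSpace ℝ (Fin 3)) ρ₂, ∀ y ∈ Metric.ball (0 : EuclideanSpace ℝ (Fin 3)) ρ₂,
            |t - s| ≤ η → dist x y ≤ η →
              |x 2 * (Real.sqrt (ν * (T - t) + ‖x‖ ^ 2))⁻¹ - y 2 * (Real.sqrt (ν * (T - s) + ‖y‖ ^ 2))⁻¹| ≤ ε)) := by
  rintro ⟨ρ₂, hρ₂, -, H⟩
  obtain ⟨η, hη, H⟩ := H (1 / 2) (by norm_num)
  set lam : ℝ := min η (ρ₂ / 2) with hlam_def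
  have hlam : 0 < lam := lt_min hη (by linarith)
  have hlamη : lam ≤ η := min_le_left _ _
  have hlamρ : lam < ρ₂ := (min_le_right _ _).trans_lt (by linarith)
  set μ : ℝ := min (ρ₂ ^ 2 / 2) (lam ^ 2 / ν) with hμ_def
  have hμ : 0 < μ := lt_min (by positivity) (by positivity)
  have hμρ : μ < ρ₂ ^ 2 := (min_le_left _ _).trans_lt (by nlinarith)
  have hμlam : ν * μ ≤ lam ^ 2 := by
    have := min_le_right (ρ₂ ^ 2 / 2) (lam ^ 2 / ν)
    rw [← hμ_def] at this
    calc ν * μ ≤ ν * (lam ^ 2 / ν) := mul_le_mul_of_nonneg_left this hν.le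
      _ = lam ^ 2 := by field_simp
  have ht : T - μ ∈ Set.Ioo (T - ρ₂ ^ 2) T := ⟨by linarith, by linarith⟩
  set x : EuclideanSpace ℝ (Fin 3) := EuclideanSpace.single (2 : Fin 3) lam with hx_def
  have hxn : ‖x‖ = lam := by
    rw [hx_def, EuclideanSpace.norm_eq]
    simp [Real.sqrt_sq hlam.le]
  have hx : x ∈ Metric.ball (0 : EuclideanSpace ℝ (Fin 3)) ρ₂ := by
    rw [Metric.mem_ball, dist_zero_right, hxn]; exact hlamρ
  have h := H (T - μ) ht (T - μ) ht x hx 0 (Metric.mem_ball_self hρ₂) (by simp [hη.le])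
    (by rw [dist_zero_right, hxn]; exact hlamη)
  have hx2 : x 2 = lam := by simp [hx_def]
  rw [hx2, hxn] at h
  simp only [PiLp.zero_apply, zero_mul, sub_zero, sub_sub_cancel] at h
  -- `h : |lam * (√(νμ + lam²))⁻¹| ≤ 1/2`, but the quotient exceeds `1/2`
  have hS : 0 < ν * μ + lam ^ 2 := by positivity
  have hq : 0 < Real.sqrt (ν * μ + lam ^ 2) := Real.sqrt_pos.2 hS
  have hlt : Real.sqrt (ν * μ + lam ^ 2) < 2 * lam := by
    rw [Real.sqrt_lt' (by positivity)]
    nlinarith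
  rw [abs_of_pos (mul_pos hlam (inv_pos.2 hq)), ← div_eq_mul_inv, div_le_iff₀ hq] at h
  linarith

/-- **`stub_momentumUniformContinuity` is false** (the registered signature of the birth skeleton of crux
`CriticalSwirlRegularity`, negated): the rest state `u ≡ 0`, `p ≡ 0` (classical, Leray–Hopf, rapidly decaying
datum), the vertex `x₀ = 0`, `ν = 1`, `T = 2`, `ρ = 1`, `C₀ = 8`, `M = 1`, the self-similar momentum
`α(t,x) = x₂/√((2−t)+‖x‖²)`, `d = cylRadius` and the drift of `restState_axisGauge` satisfy the locally-thin gauge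
block, while `α` has no modulus of continuity at `(T, 0)` (`not_uniformlyContinuous_momentum`). [folklore] -/
theorem stub_momentumUniformContinuity_false :
    ¬ (∀ (ν T : ℝ), 0 < ν → 0 < T →
      ∀ (u : ℝ → EuclideanSpace ℝ (Fin 3) → EuclideanSpace ℝ (Fin 3)) (p : ℝ → EuclideanSpace ℝ (Fin 3) → ℝ),
        Literature.Analysis.FluidPDE.IsClassicalNSSolutionOn (Set.Ico 0 T) ν 0 u p →
        Literature.Analysis.FluidPDE.IsLerayHopfOn T ν 0 (u 0) u →
        Literature.Analysis.FluidPDE.HasRapidSpatialDecay (u 0) →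
      ∀ (x₀ : EuclideanSpace ℝ (Fin 3)) (ρ C₀ M : ℝ) (α : ℝ → EuclideanSpace ℝ (Fin 3) → ℝ) (b : ℝ → EuclideanSpace ℝ (Fin 3) → EuclideanSpace ℝ (Fin 3)) (d : ℝ → EuclideanSpace ℝ (Fin 3) → ℝ),
        (0 < ρ ∧ ρ ^ 2 < T ∧ ContDiffOn ℝ 2 (Function.uncurry α) (Set.Ioo (T - ρ ^ 2) T ×ˢ Metric.ball x₀ ρ) ∧
          (∀ t ∈ Set.Ioo (T - ρ ^ 2) T, ∀ (y : EuclideanSpace ℝ (Fin 3)) (s : ℝ), 0 < s → Metric.ball y s ⊆ Metric.ball x₀ ρ →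
            ∀ δ ∈ Set.Ioo 0 s, MeasureTheory.volume ({x | d t x < δ} ∩ Metric.ball y s) ≤ ENNReal.ofReal (C₀ * δ ^ 2 * s)) ∧
          (∀ t ∈ Set.Ioo (T - ρ ^ 2) T, ∀ x ∈ Metric.ball x₀ ρ, |α t x| ≤ M ∧
            inner ℝ (Literature.Analysis.FluidPDE.curl (u t) x) (gradient (α t) x) = 0 ∧
            (0 < d t x → ‖Literature.Analysis.FluidPDE.curl (u t) x‖ * d t x ≤ C₀ * ‖gradient (α t) x‖ ∧ ‖b t x‖ * d t x ≤ C₀ ∧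
              deriv (fun s => α s x) t + Literature.Analysis.FluidPDE.convect (u t) (α t) x =
                ν * (Laplacian.laplacian (α t) x + inner ℝ (b t x) (gradient (α t) x))))) →
        ∃ ρ₂ : ℝ, 0 < ρ₂ ∧ ρ₂ ≤ ρ ∧
          (∀ ε : ℝ, 0 < ε → ∃ η : ℝ, 0 < η ∧
            ∀ t ∈ Set.Ioo (T - ρ₂ ^ 2) T, ∀ s ∈ Set.Ioo (T - ρ₂ ^ 2) T, ∀ x ∈ Metric.ball x₀ ρ₂, ∀ y ∈ Metric.ball x₀ ρ₂,
              |t - s| ≤ η → dist x y ≤ η → |α t x - α s y| ≤ ε)) := by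
  intro H
  obtain ⟨b, hG⟩ := restState_axisGauge (ν := 1) (T := 2) (ρ := 1) one_pos one_pos (by norm_num)
  have h := H 1 2 one_pos two_pos 0 0 (isClassicalNSSolutionOn_zero _ _) (isLerayHopfOn_zero _ _)
    EulerProximatePump.Negative.hasRapidSpatialDecay_zero 0 1 8 1
    (fun t x => x 2 * (Real.sqrt (1 * (2 - t) + ‖x‖ ^ 2))⁻¹) b (fun _ x => cylRadius x) hG
  exact not_uniformlyContinuous_momentum (ν := 1) (T := 2) (ρ := 1) one_pos h

end Summit.NavierStokesRegularity.NavierStokesRegularity.Theorems.CriticalSwirlRegularity.Negative
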